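import Literature.Analysis.ODE.LinearComparison
import Mathlib.Analysis.SpecialFunctions.Sqrt
import Mathlib.Analysis.Calculus.MeanValue
import Mathlib.Analysis.SpecialFunctions.Integrals.Basic
import HarnessLib

/-!
# Tao's cascade ODE, §6.7 "dynamics at the zero scale", I: the a priori estimates (6.145)–(6.149)

T. Tao, *Finite time blowup for an averaged three-dimensional Navier–Stokes equation*,
J. Amer. Math. Soc. **29** (2016), 601–674 = arXiv:1402.0290v3, §6.7 (equation numbers of arXiv v3).
In the proof of Prop. 6.15 (hence of Props. 6.12, 6.5, 6.4, 6.3 and Thm. 6.2) the modes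
`a₀, b₀, c₀, d₀, a₁` of the rescaled system obey, on the bootstrap interval, the five equations
(6.129)–(6.133)

  `∂ₜa₀ = -ε⁻² c₀ d₀ + O(K⁻⁹)`, `∂ₜb₀ = ε a₀² - ε⁻¹K^{10} c₀² + O(δ)`,
  `∂ₜc₀ = ε² e^{-K^{10}} a₀² + ε⁻¹K^{10} b₀ c₀ + O(δ)`,
  `∂ₜd₀ = ε⁻² c₀ a₀ - (1+ε₀)^{5/2} K d₀ a₁ + O(δ)`, `∂ₜa₁ = (1+ε₀)^{5/2} K d₀² + O(K⁻¹|a₁|) + O(K^{-20})`,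

and §6.7 opens with four consequences of their *algebraic structure* (three exact cancellations):
(6.146) `a₀²+b₀²+c₀²+d₀²+a₁²` is almost conserved; (6.147) `(b₀²+c₀²)^{1/2}` grows at most
linearly ("`∂ₜ(b₀²+c₀²)^{1/2} ≤ (1+O(K⁻¹)) ε`, interpreting the derivative in a weak sense");
(6.148) Grönwall for `c₀` with the rate `ε⁻¹K^{10}|b₀|`; (6.149)–(6.150) Grönwall for
`(d₀²+a₁²)^{1/2}` driven by `ε⁻²|c₀|`.

This file proves these four estimates as **stand-alone real-variable statements**: the five modes
are arbitrary functions `C¹` on a half-line `[τ₀, +∞)` (the convention of `TaoCascade.RescaledSystem`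
/ `TaoODESystem`: one-sided `derivWithin _ (Ici τ₀)`), the coefficients `ρ` (= `ε⁻²`), `ε`, `μ`
(= `ε⁻¹K^{10}`), `λ` (= `ε² e^{-K^{10}}`), `κ` (= `(1+ε₀)^{5/2}K`), `ν` (= `K⁻¹`) and the error levels
`η₁, η₂, η₃` are free real parameters, and the conclusions carry explicit constants — so that they
can be instantiated inside any packaging of the bootstrap of §6.5–6.7. The two folklore tools used
("derivative of a square root in a weak sense") are proved first: `sqrt_le_of_deriv_right_le`
(if `W' ≤ 2α√W + 2κW` then `√W(t) ≤ e^{κ(t-a)}(√W(a) + ∫_a^t α)`), via `√(W + ι)`, `ι ↓ 0`, and the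
variable-coefficient Grönwall inequalities of `Literature/Analysis/ODE/LinearComparison.lean`.

## References

* T. Tao, J. Amer. Math. Soc. 29 (2016), 601–674, arXiv:1402.0290v3, §6.6 (6.129)–(6.133), §6.7
  (6.145)–(6.150). [`Tao2016AveragedNS`]
* P. Hartman, *Ordinary Differential Equations*, 2nd ed., SIAM 2002, Ch. III §1 (Grönwall). [folklore]
-/

noncomputable section

open Set MeasureTheory intervalIntegral Filter Topology

namespace Literature.Analysis.FluidPDE

namespace TaoCascade

open Literature.Analysis.ODE

/-! ## Folklore: square roots of supersolutions -/

/-- `√(x + ι) ≤ √x + √ι` for `x, ι ≥ 0`. [folklore] -/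
theorem sqrt_add_le_sqrt_add_sqrt {x ι : ℝ} (hx : 0 ≤ x) (hι : 0 ≤ ι) :
    Real.sqrt (x + ι) ≤ Real.sqrt x + Real.sqrt ι := by
  rw [Real.sqrt_le_left (by positivity)]
  nlinarith [Real.sq_sqrt hx, Real.sq_sqrt hι, Real.sqrt_nonneg x, Real.sqrt_nonneg ι]

/-- **Square root of a supersolution ("`∂ₜ√W` in a weak sense").** Let `W ≥ 0` be continuous on
`[a, b]` with right derivative `W'` on `[a, b)`, `α ≥ 0` continuous on `[a, b]`, `κ ≥ 0`, and
`W' ≤ 2 α √W + 2 κ W` on `[a, b)`. Then `√W(t) ≤ e^{κ(t-a)} (√W(a) + ∫_a^t α)` for `t ∈ [a, b]`.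
(Proof: `h = √(W+ι)` is differentiable with `h' ≤ α + κ h`; let `ι ↓ 0`.) [folklore] -/
theorem sqrt_le_of_deriv_right_le {a b : ℝ} {W W' α : ℝ → ℝ} {κ : ℝ}
    (hW : ContinuousOn W (Icc a b)) (hW' : ∀ t ∈ Ico a b, HasDerivWithinAt W (W' t) (Ici t) t)
    (hW0 : ∀ t ∈ Icc a b, 0 ≤ W t) (hα : ContinuousOn α (Icc a b)) (hα0 : ∀ t ∈ Icc a b, 0 ≤ α t)
    (hκ : 0 ≤ κ) (bound : ∀ t ∈ Ico a b, W' t ≤ 2 * α t * Real.sqrt (W t) + 2 * κ * W t) {t : ℝ}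
    (ht : t ∈ Icc a b) :
    Real.sqrt (W t) ≤ Real.exp (κ * (t - a)) * (Real.sqrt (W a) + ∫ s in a..t, α s) := by
  have hint0 : 0 ≤ ∫ s in a..t, α s := integral_nonneg ht.1 fun s hs => hα0 s ⟨hs.1, hs.2.trans ht.2⟩
  -- it suffices to prove the bound up to an arbitrary `ι' > 0`
  refine le_of_forall_pos_lt_add fun ι' hι' => ?_
  -- choose `ι > 0` with `e^{κ(t-a)} √ι < ι'`
  set E : ℝ := Real.exp (κ * (t - a)) with hE
  have hEpos : 0 < E := Real.exp_pos _
  set ι : ℝ := (ι' / (2 * E)) ^ 2 with hι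
  have hιpos : 0 < ι := by positivity
  have hsqrtι : Real.sqrt ι = ι' / (2 * E) := by
    rw [hι, Real.sqrt_sq (by positivity)]
  -- `h = √(W + ι)`
  set h : ℝ → ℝ := fun s => Real.sqrt (W s + ι) with hh
  have hpos : ∀ s ∈ Icc a b, 0 < W s + ι := fun s hs => by linarith [hW0 s hs]
  have hhc : ContinuousOn h (Icc a b) := (hW.add continuousOn_const).sqrt
  have hh' : ∀ s ∈ Ico a b,
      HasDerivWithinAt h (W' s / (2 * Real.sqrt (W s + ι))) (Ici s) s := by
    intro s hs
    have := ((hW' s hs).add_const ι).sqrt (hpos s (Ico_subset_Icc_self hs)).ne'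
    simpa using this
  have hbound : ∀ s ∈ Ico a b, W' s / (2 * Real.sqrt (W s + ι)) ≤ α s + κ * h s := by
    intro s hs
    have hs' := Ico_subset_Icc_self hs
    have hhs : 0 < Real.sqrt (W s + ι) := Real.sqrt_pos.2 (hpos s hs')
    have hWle : Real.sqrt (W s) ≤ Real.sqrt (W s + ι) := Real.sqrt_le_sqrt (by linarith)
    have hsq : W s ≤ Real.sqrt (W s + ι) ^ 2 := by
      rw [Real.sq_sqrt (hpos s hs').le]; linarith
    rw [div_le_iff₀ (by positivity)]
    have h1 := bound s hs
    have h2 : 2 * α s * Real.sqrt (W s) ≤ 2 * α s * Real.sqrt (W s + ι) :=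
      mul_le_mul_of_nonneg_left hWle (by linarith [hα0 s hs'])
    have h3 : 2 * κ * W s ≤ 2 * κ * Real.sqrt (W s + ι) ^ 2 :=
      mul_le_mul_of_nonneg_left hsq (by linarith)
    show W' s ≤ (α s + κ * Real.sqrt (W s + ι)) * (2 * Real.sqrt (W s + ι))
    nlinarith
  have hcomp := le_linearComparison hhc hh' hα continuousOn_const (β := fun _ => κ) hbound ht
  -- simplify the comparison function
  have hβ : ∫ s in a..t, (fun _ => κ) s = κ * (t - a) := by
    simp only [intervalIntegral.integral_const, smul_eq_mul]; ring
  have hA : ∫ s in a..t, α s * Real.exp (-(∫ u in a..s, (fun _ => κ) u)) ≤ ∫ s in a..t, α s := by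
    apply integral_mono_on ht.1
    · refine ContinuousOn.intervalIntegrable_of_Icc ht.1 ?_
      refine (hα.mono (Icc_subset_Icc le_rfl ht.2)).mul ?_
      refine Continuous.continuousOn ?_
      have : (fun s => Real.exp (-(∫ u in a..s, (fun _ : ℝ => κ) u))) =
          fun s => Real.exp (-(κ * (s - a))) := by
        ext s; simp only [intervalIntegral.integral_const, smul_eq_mul]; ring_nf
      rw [this]; fun_prop
    · exact (hα.mono (Icc_subset_Icc le_rfl ht.2)).intervalIntegrable_of_Icc ht.1
    · intro s hs
      have hκs : Real.exp (-(∫ u in a..s, (fun _ : ℝ => κ) u)) ≤ 1 := by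
        rw [Real.exp_le_one_iff]
        simp only [intervalIntegral.integral_const, smul_eq_mul]
        nlinarith [hs.1, hκ]
      have := hα0 s ⟨hs.1, hs.2.trans ht.2⟩
      calc α s * Real.exp (-(∫ u in a..s, (fun _ : ℝ => κ) u)) ≤ α s * 1 :=
            mul_le_mul_of_nonneg_left hκs this
        _ = α s := mul_one _
  rw [hβ] at hcomp
  have hha : h a = Real.sqrt (W a + ι) := rfl
  have hWa : Real.sqrt (W a + ι) ≤ Real.sqrt (W a) + Real.sqrt ι :=
    sqrt_add_le_sqrt_add_sqrt (hW0 a ⟨le_rfl, ht.1.trans ht.2⟩) hιpos.le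
  calc Real.sqrt (W t) ≤ h t := Real.sqrt_le_sqrt (by linarith)
    _ ≤ E * (h a + ∫ s in a..t, α s * Real.exp (-(∫ u in a..s, (fun _ => κ) u))) := hcomp
    _ ≤ E * (Real.sqrt (W a) + Real.sqrt ι + ∫ s in a..t, α s) := by
        rw [hha]; gcongr
    _ = E * (Real.sqrt (W a) + ∫ s in a..t, α s) + E * Real.sqrt ι := by ring
    _ < E * (Real.sqrt (W a) + ∫ s in a..t, α s) + ι' := by
        rw [hsqrtι]; field_simp; nlinarith

/-- The case `κ = 0` of `sqrt_le_of_deriv_right_le`: if `W' ≤ 2 α √W` then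
`√W(t) ≤ √W(a) + ∫_a^t α`. [folklore] -/
theorem sqrt_le_sqrt_add_integral {a b : ℝ} {W W' α : ℝ → ℝ}
    (hW : ContinuousOn W (Icc a b)) (hW' : ∀ t ∈ Ico a b, HasDerivWithinAt W (W' t) (Ici t) t)
    (hW0 : ∀ t ∈ Icc a b, 0 ≤ W t) (hα : ContinuousOn α (Icc a b)) (hα0 : ∀ t ∈ Icc a b, 0 ≤ α t)
    (bound : ∀ t ∈ Ico a b, W' t ≤ 2 * α t * Real.sqrt (W t)) {t : ℝ} (ht : t ∈ Icc a b) :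
    Real.sqrt (W t) ≤ Real.sqrt (W a) + ∫ s in a..t, α s := by
  have h := sqrt_le_of_deriv_right_le hW hW' hW0 hα hα0 le_rfl (κ := 0)
    (fun s hs => by simpa using bound s hs) ht
  simpa using h

/-! ## The five-mode system: common hypotheses

Throughout, `a₀ b₀ c₀ d₀ a₁ : ℝ → ℝ` are `C¹` on `Ici τ₀`, derivatives are
`x' := derivWithin x (Ici τ₀)`, and on a time interval `[t₁, t₂]` with `τ₀ ≤ t₁` the equations
(6.129)–(6.133) hold in the form
`|a₀' + ρ c₀ d₀| ≤ η₁`, `|b₀' - (ε a₀² - μ c₀²)| ≤ η₂`, `|c₀' - (λ a₀² + μ b₀ c₀)| ≤ η₂`,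
`|d₀' - (ρ c₀ a₀ - κ d₀ a₁)| ≤ η₂`, `|a₁' - κ d₀²| ≤ ν |a₁| + η₃`
(in the source `ρ = ε⁻²`, `μ = ε⁻¹K^{10}`, `λ = ε² exp(-K^{10})`, `κ = (1+ε₀)^{5/2}K`, `ν ≍ K⁻¹`,
`η₁ ≍ K⁻⁹`, `η₂ ≍ (1+ε₀)^{-n₀/2}`, `η₃ ≍ K^{-20}`). -/

section FiveModes

variable {τ₀ t₁ t₂ : ℝ} {a₀ b₀ c₀ d₀ a₁ : ℝ → ℝ} {ρ ε μ lam κ ν η₁ η₂ η₃ M : ℝ}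

/-- **(6.146): almost conservation of `a₀²+b₀²+c₀²+d₀²+a₁²`.** Under the five-mode equations on
`[t₁, t₂]` with the sup bound `|a₀|, |b₀|, |c₀|, |d₀|, |a₁| ≤ M`, the three quadratic exchange terms
cancel exactly ("`∂ₜ(a₀²+b₀²+c₀²+d₀²+a₁²) = O(K⁻¹)`") and
`|S(t) - S(t₁)| ≤ (2M(η₁+3η₂+η₃) + 2M³(|ε|+|λ|) + 2νM²)(t - t₁)`, `S = a₀²+b₀²+c₀²+d₀²+a₁²`.
[cite: Tao2016AveragedNS, §6.7 (6.146)] -/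
theorem abs_energy_sub_le (ha₀ : ContDiffOn ℝ 1 a₀ (Ici τ₀)) (hb₀ : ContDiffOn ℝ 1 b₀ (Ici τ₀))
    (hc₀ : ContDiffOn ℝ 1 c₀ (Ici τ₀)) (hd₀ : ContDiffOn ℝ 1 d₀ (Ici τ₀))
    (ha₁ : ContDiffOn ℝ 1 a₁ (Ici τ₀)) (hτ : τ₀ ≤ t₁) (hν : 0 ≤ ν)
    (hA : ∀ t ∈ Icc t₁ t₂, |derivWithin a₀ (Ici τ₀) t + ρ * c₀ t * d₀ t| ≤ η₁)
    (hB : ∀ t ∈ Icc t₁ t₂, |derivWithin b₀ (Ici τ₀) t - (ε * a₀ t ^ 2 - μ * c₀ t ^ 2)| ≤ η₂)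
    (hC : ∀ t ∈ Icc t₁ t₂, |derivWithin c₀ (Ici τ₀) t - (lam * a₀ t ^ 2 + μ * b₀ t * c₀ t)| ≤ η₂)
    (hD : ∀ t ∈ Icc t₁ t₂,
      |derivWithin d₀ (Ici τ₀) t - (ρ * c₀ t * a₀ t - κ * d₀ t * a₁ t)| ≤ η₂)
    (hE : ∀ t ∈ Icc t₁ t₂, |derivWithin a₁ (Ici τ₀) t - κ * d₀ t ^ 2| ≤ ν * |a₁ t| + η₃)
    (hMa : ∀ t ∈ Icc t₁ t₂, |a₀ t| ≤ M) (hMb : ∀ t ∈ Icc t₁ t₂, |b₀ t| ≤ M)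
    (hMc : ∀ t ∈ Icc t₁ t₂, |c₀ t| ≤ M) (hMd : ∀ t ∈ Icc t₁ t₂, |d₀ t| ≤ M)
    (hM₁ : ∀ t ∈ Icc t₁ t₂, |a₁ t| ≤ M) {t : ℝ} (ht : t ∈ Icc t₁ t₂) :
    |(a₀ t ^ 2 + b₀ t ^ 2 + c₀ t ^ 2 + d₀ t ^ 2 + a₁ t ^ 2) -
        (a₀ t₁ ^ 2 + b₀ t₁ ^ 2 + c₀ t₁ ^ 2 + d₀ t₁ ^ 2 + a₁ t₁ ^ 2)| ≤
      (2 * M * (η₁ + 3 * η₂ + η₃) + 2 * M ^ 3 * (|ε| + |lam|) + 2 * ν * M ^ 2) * (t - t₁) := by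
  set S : ℝ → ℝ := fun s => a₀ s ^ 2 + b₀ s ^ 2 + c₀ s ^ 2 + d₀ s ^ 2 + a₁ s ^ 2 with hS
  set S' : ℝ → ℝ := fun s => 2 * (a₀ s * derivWithin a₀ (Ici τ₀) s + b₀ s * derivWithin b₀ (Ici τ₀) s +
      c₀ s * derivWithin c₀ (Ici τ₀) s + d₀ s * derivWithin d₀ (Ici τ₀) s +
        a₁ s * derivWithin a₁ (Ici τ₀) s) with hS'
  have hM0 : 0 ≤ M := (abs_nonneg _).trans (hMa t₁ ⟨le_rfl, ht.1.trans ht.2⟩)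
  have hSc : ContinuousOn S (Icc t₁ t₂) := by
    have g0 := continuousOn_Icc_of_contDiffOn ha₀ hτ (b := t₂)
    have g1 := continuousOn_Icc_of_contDiffOn hb₀ hτ (b := t₂)
    have g2 := continuousOn_Icc_of_contDiffOn hc₀ hτ (b := t₂)
    have g3 := continuousOn_Icc_of_contDiffOn hd₀ hτ (b := t₂)
    have g4 := continuousOn_Icc_of_contDiffOn ha₁ hτ (b := t₂)
    exact ((((g0.pow 2).add (g1.pow 2)).add (g2.pow 2)).add (g3.pow 2)).add (g4.pow 2)
  have hSd : ∀ s ∈ Ico t₁ t₂, HasDerivWithinAt S (S' s) (Ici s) s := by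
    intro s hs
    have hs0 : τ₀ ≤ s := hτ.trans hs.1
    have h0 := hasDerivWithinAt_Ici_of_contDiffOn ha₀ hs0
    have h1 := hasDerivWithinAt_Ici_of_contDiffOn hb₀ hs0
    have h2 := hasDerivWithinAt_Ici_of_contDiffOn hc₀ hs0
    have h3 := hasDerivWithinAt_Ici_of_contDiffOn hd₀ hs0
    have h4 := hasDerivWithinAt_Ici_of_contDiffOn ha₁ hs0
    have := (((h0.pow 2).add (h1.pow 2)).add (h2.pow 2)).add (h3.pow 2) |>.add (h4.pow 2)
    refine this.congr_deriv ?_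
    simp only [hS']
    push_cast
    ring
  -- bound on `S'`
  have hbound : ∀ s ∈ Ico t₁ t₂,
      ‖S' s‖ ≤ 2 * M * (η₁ + 3 * η₂ + η₃) + 2 * M ^ 3 * (|ε| + |lam|) + 2 * ν * M ^ 2 := by
    intro s hs
    have hs' : s ∈ Icc t₁ t₂ := Ico_subset_Icc_self hs
    -- the error terms
    set e₁ := derivWithin a₀ (Ici τ₀) s + ρ * c₀ s * d₀ s with he₁
    set e₂ := derivWithin b₀ (Ici τ₀) s - (ε * a₀ s ^ 2 - μ * c₀ s ^ 2) with he₂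
    set e₃ := derivWithin c₀ (Ici τ₀) s - (lam * a₀ s ^ 2 + μ * b₀ s * c₀ s) with he₃
    set e₄ := derivWithin d₀ (Ici τ₀) s - (ρ * c₀ s * a₀ s - κ * d₀ s * a₁ s) with he₄
    set e₅ := derivWithin a₁ (Ici τ₀) s - κ * d₀ s ^ 2 with he₅
    have key : S' s = 2 * (a₀ s * e₁ + ε * a₀ s ^ 2 * b₀ s + b₀ s * e₂ + lam * a₀ s ^ 2 * c₀ s +
        c₀ s * e₃ + d₀ s * e₄ + a₁ s * e₅) := by
      simp only [hS', he₁, he₂, he₃, he₄, he₅]; ring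
    have ha := hMa s hs'; have hb := hMb s hs'; have hc := hMc s hs'; have hd := hMd s hs'
    have h₁ := hM₁ s hs'
    have g1 : |a₀ s * e₁| ≤ M * η₁ := by
      rw [abs_mul]; exact mul_le_mul ha (hA s hs') (abs_nonneg _) hM0
    have g2 : |b₀ s * e₂| ≤ M * η₂ := by
      rw [abs_mul]; exact mul_le_mul hb (hB s hs') (abs_nonneg _) hM0
    have g3 : |c₀ s * e₃| ≤ M * η₂ := by
      rw [abs_mul]; exact mul_le_mul hc (hC s hs') (abs_nonneg _) hM0
    have g4 : |d₀ s * e₄| ≤ M * η₂ := by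
      rw [abs_mul]; exact mul_le_mul hd (hD s hs') (abs_nonneg _) hM0
    have g5 : |a₁ s * e₅| ≤ M * (ν * M + η₃) := by
      rw [abs_mul]
      refine mul_le_mul h₁ ((hE s hs').trans ?_) (abs_nonneg _) hM0
      nlinarith
    have g6 : |ε * a₀ s ^ 2 * b₀ s| ≤ |ε| * M ^ 3 := by
      rw [abs_mul, abs_mul, abs_pow]
      have : |a₀ s| ^ 2 * |b₀ s| ≤ M ^ 2 * M :=
        mul_le_mul (pow_le_pow_left₀ (abs_nonneg _) ha 2) hb (abs_nonneg _) (by positivity)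
      nlinarith [abs_nonneg ε]
    have g7 : |lam * a₀ s ^ 2 * c₀ s| ≤ |lam| * M ^ 3 := by
      rw [abs_mul, abs_mul, abs_pow]
      have : |a₀ s| ^ 2 * |c₀ s| ≤ M ^ 2 * M :=
        mul_le_mul (pow_le_pow_left₀ (abs_nonneg _) ha 2) hc (abs_nonneg _) (by positivity)
      nlinarith [abs_nonneg lam]
    rw [Real.norm_eq_abs, key, abs_mul, abs_two]
    have hsum := abs_add_le (a₀ s * e₁ + ε * a₀ s ^ 2 * b₀ s + b₀ s * e₂ + lam * a₀ s ^ 2 * c₀ s +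
        c₀ s * e₃ + d₀ s * e₄) (a₁ s * e₅)
    have hsum2 := abs_add_le (a₀ s * e₁ + ε * a₀ s ^ 2 * b₀ s + b₀ s * e₂ + lam * a₀ s ^ 2 * c₀ s +
        c₀ s * e₃) (d₀ s * e₄)
    have hsum3 := abs_add_le (a₀ s * e₁ + ε * a₀ s ^ 2 * b₀ s + b₀ s * e₂ + lam * a₀ s ^ 2 * c₀ s)
        (c₀ s * e₃)
    have hsum4 := abs_add_le (a₀ s * e₁ + ε * a₀ s ^ 2 * b₀ s + b₀ s * e₂) (lam * a₀ s ^ 2 * c₀ s)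
    have hsum5 := abs_add_le (a₀ s * e₁ + ε * a₀ s ^ 2 * b₀ s) (b₀ s * e₂)
    have hsum6 := abs_add_le (a₀ s * e₁) (ε * a₀ s ^ 2 * b₀ s)
    have hM3 : 0 ≤ M ^ 3 := by positivity
    linarith
  have hmvt := norm_image_sub_le_of_norm_deriv_right_le_segment hSc hSd hbound t ht
  rw [Real.norm_eq_abs] at hmvt
  exact hmvt

/-- **(6.147): linear growth of `(b₀²+c₀²)^{1/2}`.** Under the `b₀`- and `c₀`-equations on
`[t₁, t₂]` with `a₀² ≤ A²` there and `0 ≤ λ ≤ ε`, the exchange terms `∓ε⁻¹K^{10}b₀c₀²` cancel in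
`∂ₜ(b₀²+c₀²)` and ("`∂ₜ(b₀²+c₀²)^{1/2} ≤ (1 + O(K⁻¹)) ε` in a weak sense")
`√(b₀²+c₀²)(t) ≤ √(b₀²+c₀²)(t₁) + (√2 ε A² + √2 η₂)(t - t₁)`; in particular `|b₀(t)|` and `|c₀(t)|`
obey this bound. [cite: Tao2016AveragedNS, §6.7 (6.147)] -/
theorem sqrt_sq_add_sq_le (hb₀ : ContDiffOn ℝ 1 b₀ (Ici τ₀)) (hc₀ : ContDiffOn ℝ 1 c₀ (Ici τ₀))
    (hτ : τ₀ ≤ t₁) (hε : 0 ≤ ε) (hlam : 0 ≤ lam)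
    (hlamε : lam ≤ ε) (hη₂ : 0 ≤ η₂) {A : ℝ} (hA : ∀ t ∈ Icc t₁ t₂, a₀ t ^ 2 ≤ A ^ 2)
    (hB : ∀ t ∈ Icc t₁ t₂, |derivWithin b₀ (Ici τ₀) t - (ε * a₀ t ^ 2 - μ * c₀ t ^ 2)| ≤ η₂)
    (hC : ∀ t ∈ Icc t₁ t₂, |derivWithin c₀ (Ici τ₀) t - (lam * a₀ t ^ 2 + μ * b₀ t * c₀ t)| ≤ η₂)
    {t : ℝ} (ht : t ∈ Icc t₁ t₂) :
    Real.sqrt (b₀ t ^ 2 + c₀ t ^ 2) ≤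
      Real.sqrt (b₀ t₁ ^ 2 + c₀ t₁ ^ 2) + (Real.sqrt 2 * ε * A ^ 2 + Real.sqrt 2 * η₂) * (t - t₁) := by
  set W : ℝ → ℝ := fun s => b₀ s ^ 2 + c₀ s ^ 2 with hW
  set W' : ℝ → ℝ := fun s => 2 * (b₀ s * derivWithin b₀ (Ici τ₀) s +
      c₀ s * derivWithin c₀ (Ici τ₀) s) with hW'
  have hWc : ContinuousOn W (Icc t₁ t₂) :=
    ((continuousOn_Icc_of_contDiffOn hb₀ hτ).pow 2).add ((continuousOn_Icc_of_contDiffOn hc₀ hτ).pow 2)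
  have hWd : ∀ s ∈ Ico t₁ t₂, HasDerivWithinAt W (W' s) (Ici s) s := by
    intro s hs
    have hs0 : τ₀ ≤ s := hτ.trans hs.1
    have := ((hasDerivWithinAt_Ici_of_contDiffOn hb₀ hs0).pow 2).add ((hasDerivWithinAt_Ici_of_contDiffOn hc₀ hs0).pow 2)
    refine this.congr_deriv ?_
    simp only [hW']; push_cast; ring
  have hW0 : ∀ s ∈ Icc t₁ t₂, 0 ≤ W s := fun s _ => by positivity
  -- `W' ≤ 2 (√2 ε A² + √2 η₂) √W`
  have h2 : (1 : ℝ) ≤ Real.sqrt 2 := by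
    rw [Real.le_sqrt (by norm_num) (by norm_num)]; norm_num
  have hbound : ∀ s ∈ Ico t₁ t₂,
      W' s ≤ 2 * ((fun _ => Real.sqrt 2 * ε * A ^ 2 + Real.sqrt 2 * η₂) s) * Real.sqrt (W s) := by
    intro s hs
    have hs' : s ∈ Icc t₁ t₂ := Ico_subset_Icc_self hs
    set e₂ := derivWithin b₀ (Ici τ₀) s - (ε * a₀ s ^ 2 - μ * c₀ s ^ 2) with he₂
    set e₃ := derivWithin c₀ (Ici τ₀) s - (lam * a₀ s ^ 2 + μ * b₀ s * c₀ s) with he₃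
    have key : W' s = 2 * (ε * a₀ s ^ 2 * b₀ s + lam * a₀ s ^ 2 * c₀ s + b₀ s * e₂ + c₀ s * e₃) := by
      simp only [hW', he₂, he₃]; ring
    -- `|b₀|, |c₀| ≤ √W` and `|b₀| + |c₀| ≤ √2 √W`
    have hbW : |b₀ s| ≤ Real.sqrt (W s) := by
      rw [← Real.sqrt_sq_eq_abs]; exact Real.sqrt_le_sqrt (by simp only [hW]; nlinarith)
    have hcW : |c₀ s| ≤ Real.sqrt (W s) := by
      rw [← Real.sqrt_sq_eq_abs]; exact Real.sqrt_le_sqrt (by simp only [hW]; nlinarith)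
    have hsumW : |b₀ s| + |c₀ s| ≤ Real.sqrt 2 * Real.sqrt (W s) := by
      rw [← Real.sqrt_mul (by norm_num : (0:ℝ) ≤ 2), Real.le_sqrt (by positivity) (by positivity)]
      simp only [hW]
      nlinarith [sq_abs (b₀ s), sq_abs (c₀ s), sq_nonneg (|b₀ s| - |c₀ s|)]
    have hAs := hA s hs'
    have he₂b := hB s hs'
    have he₃b := hC s hs'
    rw [key]
    have t1 : ε * a₀ s ^ 2 * b₀ s ≤ ε * A ^ 2 * |b₀ s| := by
      have : a₀ s ^ 2 * b₀ s ≤ A ^ 2 * |b₀ s| := by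
        calc a₀ s ^ 2 * b₀ s ≤ a₀ s ^ 2 * |b₀ s| :=
              mul_le_mul_of_nonneg_left (le_abs_self _) (sq_nonneg _)
          _ ≤ A ^ 2 * |b₀ s| := mul_le_mul_of_nonneg_right hAs (abs_nonneg _)
      nlinarith
    have t2 : lam * a₀ s ^ 2 * c₀ s ≤ ε * A ^ 2 * |c₀ s| := by
      have : a₀ s ^ 2 * c₀ s ≤ A ^ 2 * |c₀ s| := by
        calc a₀ s ^ 2 * c₀ s ≤ a₀ s ^ 2 * |c₀ s| :=
              mul_le_mul_of_nonneg_left (le_abs_self _) (sq_nonneg _)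
          _ ≤ A ^ 2 * |c₀ s| := mul_le_mul_of_nonneg_right hAs (abs_nonneg _)
      have h3 : lam * (A ^ 2 * |c₀ s|) ≤ ε * (A ^ 2 * |c₀ s|) :=
        mul_le_mul_of_nonneg_right hlamε (by positivity)
      nlinarith
    have t3 : b₀ s * e₂ ≤ |b₀ s| * η₂ := by
      calc b₀ s * e₂ ≤ |b₀ s * e₂| := le_abs_self _
        _ = |b₀ s| * |e₂| := abs_mul _ _
        _ ≤ |b₀ s| * η₂ := mul_le_mul_of_nonneg_left he₂b (abs_nonneg _)
    have t4 : c₀ s * e₃ ≤ |c₀ s| * η₂ := by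
      calc c₀ s * e₃ ≤ |c₀ s * e₃| := le_abs_self _
        _ = |c₀ s| * |e₃| := abs_mul _ _
        _ ≤ |c₀ s| * η₂ := mul_le_mul_of_nonneg_left he₃b (abs_nonneg _)
    have hWs := Real.sqrt_nonneg (W s)
    nlinarith [mul_nonneg hε (sq_nonneg A), abs_nonneg (b₀ s), abs_nonneg (c₀ s)]
  have h := sqrt_le_sqrt_add_integral hWc hWd hW0 continuousOn_const
    (fun s _ => by positivity) hbound ht
  have hI : ∫ s in t₁..t, (fun _ : ℝ => Real.sqrt 2 * ε * A ^ 2 + Real.sqrt 2 * η₂) s =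
      (Real.sqrt 2 * ε * A ^ 2 + Real.sqrt 2 * η₂) * (t - t₁) := by
    simp only [intervalIntegral.integral_const, smul_eq_mul]; ring
  rw [hI] at h
  exact h

/-- **(6.148): Grönwall for `c₀`.** Under the `c₀`-equation on `[t₁, t₂]`,
`|c₀(t)| ≤ exp(∫_{t₁}^t |μ b₀|) (|c₀(t₁)| + ∫_{t₁}^t (|λ| a₀² + η₂))` ("by (6.56) and Gronwall's
inequality"). [cite: Tao2016AveragedNS, §6.7 (6.148)] -/
theorem abs_c_le_exp_integral (hc₀ : ContDiffOn ℝ 1 c₀ (Ici τ₀)) (ha₀c : ContinuousOn a₀ (Icc t₁ t₂))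
    (hb₀c : ContinuousOn b₀ (Icc t₁ t₂)) (hτ : τ₀ ≤ t₁) (hη₂ : 0 ≤ η₂)
    (hC : ∀ t ∈ Icc t₁ t₂, |derivWithin c₀ (Ici τ₀) t - (lam * a₀ t ^ 2 + μ * b₀ t * c₀ t)| ≤ η₂)
    {t : ℝ} (ht : t ∈ Icc t₁ t₂) :
    |c₀ t| ≤ Real.exp (∫ s in t₁..t, |μ * b₀ s|) *
      (|c₀ t₁| + ∫ s in t₁..t, (|lam| * a₀ s ^ 2 + η₂)) := by
  refine abs_le_linearComparison (continuousOn_Icc_of_contDiffOn hc₀ hτ)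
    (fun s hs => hasDerivWithinAt_Ici_of_contDiffOn hc₀ (hτ.trans hs.1))
    (R := fun s => |lam| * a₀ s ^ 2 + η₂) (β := fun s => μ * b₀ s) ?_ (fun s _ => by positivity)
    (continuousOn_const.mul hb₀c) ?_ ht
  · exact ((continuousOn_const.mul (ha₀c.pow 2)).add continuousOn_const)
  · intro s hs
    have h := hC s (Ico_subset_Icc_self hs)
    have : derivWithin c₀ (Ici τ₀) s - μ * b₀ s * c₀ s =
        (derivWithin c₀ (Ici τ₀) s - (lam * a₀ s ^ 2 + μ * b₀ s * c₀ s)) + lam * a₀ s ^ 2 := by ring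
    rw [this]
    refine (abs_add_le _ _).trans ?_
    rw [abs_mul, abs_pow, sq_abs]
    linarith

/-- The rate integral of (6.148) under an affine bound on `b₀` (as provided by (6.147)): if
`|b₀(s)| ≤ p + σ (s - t₁)` on `[t₁, t]` then `∫_{t₁}^t |μ b₀| ≤ |μ| (p (t-t₁) + σ (t-t₁)²/2)`.
[cite: Tao2016AveragedNS, §6.7 (6.148)] -/
theorem integral_abs_mul_le_of_affine (hb₀c : ContinuousOn b₀ (Icc t₁ t₂)) {p σ : ℝ} {t : ℝ}
    (ht : t ∈ Icc t₁ t₂) (hb : ∀ s ∈ Icc t₁ t, |b₀ s| ≤ p + σ * (s - t₁)) :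
    ∫ s in t₁..t, |μ * b₀ s| ≤ |μ| * (p * (t - t₁) + σ * (t - t₁) ^ 2 / 2) := by
  have hcont : ContinuousOn (fun s => |μ * b₀ s|) (Icc t₁ t) :=
    (continuousOn_const.mul (hb₀c.mono (Icc_subset_Icc le_rfl ht.2))).abs
  have haff : ContinuousOn (fun s => |μ| * (p + σ * (s - t₁))) (Icc t₁ t) := by fun_prop
  calc ∫ s in t₁..t, |μ * b₀ s| ≤ ∫ s in t₁..t, |μ| * (p + σ * (s - t₁)) := by
        apply integral_mono_on ht.1 (hcont.intervalIntegrable_of_Icc ht.1)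
          (haff.intervalIntegrable_of_Icc ht.1)
        intro s hs
        rw [abs_mul]
        exact mul_le_mul_of_nonneg_left (hb s hs) (abs_nonneg _)
    _ = |μ| * (p * (t - t₁) + σ * (t - t₁) ^ 2 / 2) := by
        rw [intervalIntegral.integral_const_mul]
        congr 1
        have : (fun s => p + σ * (s - t₁)) = fun s => σ * s + (p - σ * t₁) := by ext s; ring
        have h1 : IntervalIntegrable (fun s : ℝ => σ * s) volume t₁ t :=
          (continuous_const.mul continuous_id).intervalIntegrable _ _
        have h2 : IntervalIntegrable (fun _ : ℝ => p - σ * t₁) volume t₁ t :=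
          continuous_const.intervalIntegrable _ _
        rw [this, intervalIntegral.integral_add h1 h2, intervalIntegral.integral_const_mul,
          integral_id, intervalIntegral.integral_const, smul_eq_mul]
        ring

/-- **(6.149)–(6.150): Grönwall for `(d₀²+a₁²)^{1/2}`.** Under the `d₀`- and `a₁`-equations on
`[t₁, t₂]` with `|a₀| ≤ M`, `ρ, ν ≥ 0`, the exchange terms `∓κ d₀² a₁` cancel in `∂ₜ(d₀²+a₁²)`
("`∂ₜ(d₀²+a₁²)^{1/2} = O(ε⁻²|c₀|) + O(K⁻¹(d₀²+a₁²)^{1/2}) + O(K^{-20})`") and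
`√(d₀²+a₁²)(t) ≤ e^{ν(t-t₁)} (√(d₀²+a₁²)(t₁) + ∫_{t₁}^t (ρ M |c₀| + η₂ + η₃))`.
[cite: Tao2016AveragedNS, §6.7 (6.149)–(6.150)] -/
theorem sqrt_d_sq_add_a_sq_le (hd₀ : ContDiffOn ℝ 1 d₀ (Ici τ₀)) (ha₁ : ContDiffOn ℝ 1 a₁ (Ici τ₀))
    (hc₀c : ContinuousOn c₀ (Icc t₁ t₂)) (hτ : τ₀ ≤ t₁) (hρ : 0 ≤ ρ) (hν : 0 ≤ ν) (hη₂ : 0 ≤ η₂)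
    (hη₃ : 0 ≤ η₃) (hMa : ∀ t ∈ Icc t₁ t₂, |a₀ t| ≤ M)
    (hD : ∀ t ∈ Icc t₁ t₂,
      |derivWithin d₀ (Ici τ₀) t - (ρ * c₀ t * a₀ t - κ * d₀ t * a₁ t)| ≤ η₂)
    (hE : ∀ t ∈ Icc t₁ t₂, |derivWithin a₁ (Ici τ₀) t - κ * d₀ t ^ 2| ≤ ν * |a₁ t| + η₃)
    {t : ℝ} (ht : t ∈ Icc t₁ t₂) :
    Real.sqrt (d₀ t ^ 2 + a₁ t ^ 2) ≤ Real.exp (ν * (t - t₁)) *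
      (Real.sqrt (d₀ t₁ ^ 2 + a₁ t₁ ^ 2) + ∫ s in t₁..t, (ρ * M * |c₀ s| + η₂ + η₃)) := by
  set W : ℝ → ℝ := fun s => d₀ s ^ 2 + a₁ s ^ 2 with hW
  set W' : ℝ → ℝ := fun s => 2 * (d₀ s * derivWithin d₀ (Ici τ₀) s +
      a₁ s * derivWithin a₁ (Ici τ₀) s) with hW'
  have hM0 : 0 ≤ M := (abs_nonneg _).trans (hMa t₁ ⟨le_rfl, ht.1.trans ht.2⟩)
  have hWc : ContinuousOn W (Icc t₁ t₂) :=
    ((continuousOn_Icc_of_contDiffOn hd₀ hτ).pow 2).add ((continuousOn_Icc_of_contDiffOn ha₁ hτ).pow 2)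
  have hWd : ∀ s ∈ Ico t₁ t₂, HasDerivWithinAt W (W' s) (Ici s) s := by
    intro s hs
    have hs0 : τ₀ ≤ s := hτ.trans hs.1
    have := ((hasDerivWithinAt_Ici_of_contDiffOn hd₀ hs0).pow 2).add ((hasDerivWithinAt_Ici_of_contDiffOn ha₁ hs0).pow 2)
    refine this.congr_deriv ?_
    simp only [hW']; push_cast; ring
  have hW0 : ∀ s ∈ Icc t₁ t₂, 0 ≤ W s := fun s _ => by positivity
  set α : ℝ → ℝ := fun s => ρ * M * |c₀ s| + η₂ + η₃ with hα
  have hαc : ContinuousOn α (Icc t₁ t₂) :=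
    ((continuousOn_const.mul hc₀c.abs).add continuousOn_const).add continuousOn_const
  have hα0 : ∀ s ∈ Icc t₁ t₂, 0 ≤ α s := fun s _ => by positivity
  have hbound : ∀ s ∈ Ico t₁ t₂, W' s ≤ 2 * α s * Real.sqrt (W s) + 2 * ν * W s := by
    intro s hs
    have hs' : s ∈ Icc t₁ t₂ := Ico_subset_Icc_self hs
    set e₄ := derivWithin d₀ (Ici τ₀) s - (ρ * c₀ s * a₀ s - κ * d₀ s * a₁ s) with he₄
    set e₅ := derivWithin a₁ (Ici τ₀) s - κ * d₀ s ^ 2 with he₅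
    have key : W' s = 2 * (ρ * a₀ s * c₀ s * d₀ s + d₀ s * e₄ + a₁ s * e₅) := by
      simp only [hW', he₄, he₅]; ring
    have hdW : |d₀ s| ≤ Real.sqrt (W s) := by
      rw [← Real.sqrt_sq_eq_abs]; exact Real.sqrt_le_sqrt (by simp only [hW]; nlinarith)
    have haW : |a₁ s| ≤ Real.sqrt (W s) := by
      rw [← Real.sqrt_sq_eq_abs]; exact Real.sqrt_le_sqrt (by simp only [hW]; nlinarith)
    have ha := hMa s hs'
    have he₄b := hD s hs'
    have he₅b := hE s hs'
    rw [key]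
    have t1 : ρ * a₀ s * c₀ s * d₀ s ≤ ρ * M * |c₀ s| * Real.sqrt (W s) := by
      calc ρ * a₀ s * c₀ s * d₀ s ≤ |ρ * a₀ s * c₀ s * d₀ s| := le_abs_self _
        _ = ρ * |a₀ s| * |c₀ s| * |d₀ s| := by rw [abs_mul, abs_mul, abs_mul, abs_of_nonneg hρ]
        _ ≤ ρ * M * |c₀ s| * Real.sqrt (W s) := by gcongr
    have t2 : d₀ s * e₄ ≤ Real.sqrt (W s) * η₂ := by
      calc d₀ s * e₄ ≤ |d₀ s * e₄| := le_abs_self _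
        _ = |d₀ s| * |e₄| := abs_mul _ _
        _ ≤ Real.sqrt (W s) * η₂ := mul_le_mul hdW he₄b (abs_nonneg _) (Real.sqrt_nonneg _)
    have t3 : a₁ s * e₅ ≤ ν * W s + Real.sqrt (W s) * η₃ := by
      have hsq : |a₁ s| * |a₁ s| ≤ W s := by
        rw [← sq, sq_abs]; simp only [hW]; nlinarith
      calc a₁ s * e₅ ≤ |a₁ s * e₅| := le_abs_self _
        _ = |a₁ s| * |e₅| := abs_mul _ _
        _ ≤ |a₁ s| * (ν * |a₁ s| + η₃) := mul_le_mul_of_nonneg_left he₅b (abs_nonneg _)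
        _ = ν * (|a₁ s| * |a₁ s|) + |a₁ s| * η₃ := by ring
        _ ≤ ν * W s + Real.sqrt (W s) * η₃ := by gcongr
    simp only [hα]
    nlinarith [Real.sqrt_nonneg (W s)]
  exact sqrt_le_of_deriv_right_le hWc hWd hW0 hαc hα0 hν hbound ht

end FiveModes

end TaoCascade

end Literature.Analysis.FluidPDE
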